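import Literature.Algebra.Polynomial.CasasAlvero.SmallDegrees
import Literature.Algebra.Polynomial.CasasAlvero.Degree4CharP
import Literature.Algebra.Polynomial.CasasAlvero.Degree5
import Mathlib.Algebra.Field.ZMod
import Mathlib.Algebra.Field.ULift
import Mathlib.Algebra.CharP.Basic
import HarnessLib

/-!
# Casas-Alvero: the exact sets of bad primes for degrees `3`, `4`, `5`

A prime `p` is a BAD PRIME FOR DEGREE `d` [CLO 2012, (introduction).7] if there is a Casas-Alvero polynomial of degree
`d` that is not a pure power over some field of characteristic `p`, i.e. `p ∈ badPrimes d` with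
`badPrimes d = {p prime | ∃ F, char F = p ∧ ¬ HoldsInDegree F d}` (the set whose finiteness for good degrees is
`BadPrimesFinite.lean`).  This file turns the directory's field-by-field answers in degrees `3`, `4`, `5`
(`holdsInDegree_three_iff`, `holdsInDegree_four_iff`, `holdsInDegree_five_iff`) into the three published lists,
as equalities of sets of natural numbers:

* `badPrimes_three : … = {2}` [CLO 2012, (introduction).7: "p = 2 is the sole bad prime for degree 3"];
* `badPrimes_four : … = {3, 5, 7}` [De Jong–Draisma; CLO 2012, (introduction).7];
* `badPrimes_five : … = {2, 3, 7, 11, 131, 193, 599, 3541, 8009}` [CLO 2012, Thm. 4; Chellali–Salinier].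
-/

noncomputable section

open Polynomial

namespace Literature.Algebra.Polynomial.CasasAlvero

universe u

/-- From a field-by-field criterion "`CA_d(K)` iff the primes of the list `L` are non-zero in `K`" to the exact set of
bad primes `= L`. [folklore] -/
private theorem badPrimes_eq_of_iff {d : ℕ} (L : List ℕ) (hL : ∀ q ∈ L, q.Prime)
    (hiff : ∀ (K : Type u) [Field K], HoldsInDegree K d ↔ ∀ q ∈ L, (q : K) ≠ 0) :
    {p : ℕ | p.Prime ∧ ∃ (F : Type u) (_ : Field F) (_ : CharP F p), ¬ HoldsInDegree F d} = {p | p ∈ L} := by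
  ext p
  simp only [Set.mem_setOf_eq]
  constructor
  · rintro ⟨hp, F, hF, hFp, hbad⟩
    rw [hiff F] at hbad
    push Not at hbad
    obtain ⟨q, hq, hq0⟩ := hbad
    have hpq : p ∣ q := (CharP.cast_eq_zero_iff F p q).mp hq0
    rwa [(Nat.prime_dvd_prime_iff_eq hp (hL q hq)).mp hpq]
  · intro hp
    haveI : Fact p.Prime := ⟨hL p hp⟩
    refine ⟨hL p hp, ULift.{u} (ZMod p), inferInstance, inferInstance, fun h => ?_⟩
    exact (hiff (ULift.{u} (ZMod p))).mp h p hp (CharP.cast_eq_zero _ p)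

/-- **The bad primes for degree `3` are exactly `{2}`.** [cite: CastryckLaterveerOunaies2012, (introduction).7] -/
theorem badPrimes_three :
    {p : ℕ | p.Prime ∧ ∃ (F : Type u) (_ : Field F) (_ : CharP F p), ¬ HoldsInDegree F 3} = ({2} : Set ℕ) := by
  rw [badPrimes_eq_of_iff.{u} [2] (by decide) (fun K _ => by rw [holdsInDegree_three_iff K]; simp)]
  ext p; simp

/-- **The bad primes for degree `4` are exactly `{3, 5, 7}`** (De Jong–Draisma).
[cite: CastryckLaterveerOunaies2012, (introduction).7] -/
theorem badPrimes_four :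
    {p : ℕ | p.Prime ∧ ∃ (F : Type u) (_ : Field F) (_ : CharP F p), ¬ HoldsInDegree F 4} = ({3, 5, 7} : Set ℕ) := by
  rw [badPrimes_eq_of_iff.{u} [3, 5, 7] (by decide) (fun K _ => by rw [holdsInDegree_four_iff K]; simp)]
  ext p; simp

/-- **The bad primes for degree `5` are exactly `{2, 3, 7, 11, 131, 193, 599, 3541, 8009}`** [CLO 2012, Thm. 4 (d = 5);
Chellali–Salinier], here a corollary of `holdsInDegree_five_iff` (every case a Lean theorem: the nine explicit
counterexamples and the elementary elimination of `Degree5*.lean`). [cite: CastryckLaterveerOunaies2012, Thm. 4] -/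
theorem badPrimes_five :
    {p : ℕ | p.Prime ∧ ∃ (F : Type u) (_ : Field F) (_ : CharP F p), ¬ HoldsInDegree F 5} =
      ({2, 3, 7, 11, 131, 193, 599, 3541, 8009} : Set ℕ) := by
  rw [badPrimes_eq_of_iff.{u} [2, 3, 7, 11, 131, 193, 599, 3541, 8009] (by norm_num)
    (fun K _ => by rw [holdsInDegree_five_iff (K := K)]; simp)]
  ext p; simp

/-- In words: `p` is a bad prime for degree `5` iff `p ∈ {2, 3, 7, 11, 131, 193, 599, 3541, 8009}`.
[cite: CastryckLaterveerOunaies2012, Thm. 4] -/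
theorem isBadPrime_five_iff (p : ℕ) :
    (p.Prime ∧ ∃ (F : Type u) (_ : Field F) (_ : CharP F p), ¬ HoldsInDegree F 5) ↔
      p = 2 ∨ p = 3 ∨ p = 7 ∨ p = 11 ∨ p = 131 ∨ p = 193 ∨ p = 599 ∨ p = 3541 ∨ p = 8009 := by
  have h := Set.ext_iff.mp badPrimes_five.{u} p
  simpa using h

end Literature.Algebra.Polynomial.CasasAlvero
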